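import Literature.NumberTheory.LFunctions.MertensPrimeIdeals
import Mathlib.Algebra.Squarefree.Basic
import HarnessLib

/-!
# Sums over squarefree ideals bounded by Euler products

Topic `Literature/NumberTheory/Sieve`. Everything in this file is PROVED (theorems only).

The elementary majorant behind "this sort of estimation of sums by Euler products will be used
frequently in what follows without further comment" (Castillo–Hall–Lemke Oliver–Pollack–Thompson,
arXiv:1403.5808, proof of Lemma 2.2): for a Dedekind domain `R`, a finite set `P` of nonzero primes
and `h ≥ 0`,

  `∑_{𝔲} g(𝔲) ≤ ∏_{𝔭 ∈ P} (1 + h(𝔭))`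

whenever the sum runs over distinct ideals of the form `𝔲 = ∏_{𝔭 ∈ S} 𝔭`, `S ⊆ P`, and
`g(∏_{𝔭 ∈ S} 𝔭) = ∏_{𝔭 ∈ S} h(𝔭)` (`sum_le_prod_one_add`; expand the product, `Finset.prod_one_add`,
and use unique factorization of ideals: `prodIdeal_injective`). Every nonzero squarefree ideal is
such a product (`exists_eq_prodIdeal_of_squarefree`), and for `R = 𝓞_K` an ideal of norm `≤ x` has
all its prime factors of norm `≤ x`, so with the Euler-product majorants of
`LFunctions/MertensPrimeIdeals.lean`:

  `∑_{N𝔲 ≤ x, 𝔲 squarefree} ∏_{𝔭 ∣ 𝔲} a/(N𝔭 − 1) ≤ C_{K,a} (log x)^a`   (`sum_squarefree_le_log_pow`),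

the shape of the bounds `∑_{N𝔲 ≤ R} μ²(𝔲)/φ(𝔲) ≪ log R`, `∑ μ²(𝔮)τ_{3k}(𝔮)/φ(𝔮) ≪ (log R)^{3k}` of
loc. cit. Lemmas 2.2–2.3.

## References

* A. Castillo, C. Hall, R. J. Lemke Oliver, P. Pollack, L. Thompson, *Bounded gaps between primes in
  number fields and function fields*, Proc. AMS 143 (2015), arXiv:1403.5808, proof of Lemma 2.2
  (the Euler-product estimates). [CastilloEtAl2015]
* H. Halberstam, H.-E. Richert, *Sieve Methods*, Academic Press 1974, Ch. 2 §2 (the prototype over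
  `ℤ`: `∑_{d ∣ P(z)} g(d) = ∏_{p < z}(1 + g(p))`).
-/

noncomputable section

open Finset IsDedekindDomain UniqueFactorizationMonoid
open scoped NumberField Classical

namespace Literature.NumberTheory.Sieve.SquarefreeIdeal

section Dedekind

variable {R : Type*} [CommRing R] [IsDedekindDomain R]

/-- The squarefree ideal `∏_{𝔭 ∈ S} 𝔭` attached to a finite set of nonzero primes. [folklore] -/
def prodIdeal (S : Finset (HeightOneSpectrum R)) : Ideal R := ∏ v ∈ S, v.asIdeal

omit [IsDedekindDomain R] in
/-- `prodIdeal ∅ = 1`. [folklore] -/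
@[simp] theorem prodIdeal_empty : prodIdeal (∅ : Finset (HeightOneSpectrum R)) = ⊤ := by
  simp [prodIdeal, Ideal.one_eq_top]

/-- The normalized prime factorization of `∏_{𝔭 ∈ S} 𝔭` is `S`. [folklore] -/
theorem normalizedFactors_prodIdeal (S : Finset (HeightOneSpectrum R)) :
    normalizedFactors (prodIdeal S) = S.val.map HeightOneSpectrum.asIdeal := by
  rw [prodIdeal, Finset.prod_eq_multiset_prod]
  exact normalizedFactors_prod_of_prime fun p hp => by
    obtain ⟨v, -, rfl⟩ := Multiset.mem_map.1 hp
    exact v.prime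

/-- **Unique factorization**: `S ↦ ∏_{𝔭 ∈ S} 𝔭` is injective. [folklore] -/
theorem prodIdeal_injective : Function.Injective (prodIdeal (R := R)) := by
  intro S T h
  have h' := congrArg normalizedFactors h
  rw [normalizedFactors_prodIdeal, normalizedFactors_prodIdeal] at h'
  exact Finset.val_inj.1 (Multiset.map_injective
    (fun v w hvw => HeightOneSpectrum.ext hvw) h')

/-- `∏_{𝔭 ∈ S} 𝔭 ≠ 0`. [folklore] -/
theorem prodIdeal_ne_zero (S : Finset (HeightOneSpectrum R)) : prodIdeal S ≠ 0 :=
  Finset.prod_ne_zero_iff.2 fun v _ => v.ne_bot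

/-- `𝔭 ∣ ∏_{𝔮 ∈ S} 𝔮 ↔ 𝔭 ∈ S`. [folklore] -/
theorem dvd_prodIdeal_iff {S : Finset (HeightOneSpectrum R)} {v : HeightOneSpectrum R} :
    v.asIdeal ∣ prodIdeal S ↔ v ∈ S := by
  rw [UniqueFactorizationMonoid.dvd_iff_normalizedFactors_le_normalizedFactors v.ne_bot
    (prodIdeal_ne_zero S), normalizedFactors_prodIdeal,
    normalizedFactors_irreducible v.irreducible, normalize_eq, Multiset.singleton_le]
  constructor
  · intro h
    obtain ⟨w, hw, hwv⟩ := Multiset.mem_map.1 h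
    rwa [← HeightOneSpectrum.ext hwv]
  · exact fun h => Multiset.mem_map_of_mem _ h

/-- **Every nonzero squarefree ideal is `∏_{𝔭 ∈ S} 𝔭`** for the finite set `S` of its prime
factors. [folklore] -/
theorem exists_eq_prodIdeal_of_squarefree {I : Ideal R} (hI : I ≠ 0) (hsq : Squarefree I) :
    ∃ S : Finset (HeightOneSpectrum R), I = prodIdeal S := by
  set m := normalizedFactors I with hm
  have hnodup : m.Nodup := (squarefree_iff_nodup_normalizedFactors hI).1 hsq
  have hprime : ∀ p ∈ m, Prime p := fun p hp => prime_of_normalized_factor p hp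
  -- the finite set of height-one primes appearing in `m`
  have hinj : Set.InjOn (HeightOneSpectrum.asIdeal (R := R))
      (HeightOneSpectrum.asIdeal ⁻¹' ↑m.toFinset) := fun v _ w _ h => HeightOneSpectrum.ext h
  refine ⟨m.toFinset.preimage HeightOneSpectrum.asIdeal hinj, ?_⟩
  rw [prodIdeal, Finset.prod_preimage HeightOneSpectrum.asIdeal m.toFinset hinj (fun P => P)
    (fun P hP hnot => ?_)]
  · rw [Finset.prod_eq_multiset_prod, Multiset.map_id', Multiset.toFinset_val, hnodup.dedup]
    exact (associated_iff_eq.1 (prod_normalizedFactors hI)).symm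
  · exfalso
    have hPm : P ∈ m := Multiset.mem_toFinset.1 hP
    have hp := hprime P hPm
    exact hnot ⟨⟨P, Ideal.isPrime_of_prime hp, hp.ne_zero⟩, rfl⟩

/-- **Sums over squarefree ideals are bounded by Euler products**: if `h ≥ 0` on the primes of the
finite set `P`, `g(∏_{𝔭 ∈ S} 𝔭) = ∏_{𝔭 ∈ S} h(𝔭)` for all `S ⊆ P`, and `U` is a finite set of ideals
each of the form `∏_{𝔭 ∈ S} 𝔭` with `S ⊆ P`, then `∑_{𝔲 ∈ U} g(𝔲) ≤ ∏_{𝔭 ∈ P} (1 + h(𝔭))`.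
[cite: CastilloEtAl2015, proof of Lemma 2.2 (estimation of sums by Euler products)] -/
theorem sum_le_prod_one_add (P : Finset (HeightOneSpectrum R)) {h : HeightOneSpectrum R → ℝ}
    (hh : ∀ v ∈ P, 0 ≤ h v) {g : Ideal R → ℝ}
    (hg : ∀ S ⊆ P, g (prodIdeal S) = ∏ v ∈ S, h v) (U : Finset (Ideal R))
    (hU : ∀ I ∈ U, ∃ S ⊆ P, I = prodIdeal S) :
    ∑ I ∈ U, g I ≤ ∏ v ∈ P, (1 + h v) := by
  rw [Finset.prod_one_add]
  -- `U` is the image of a family of subsets of `P`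
  choose! S hSP hSI using hU
  have hUim : U = (U.image S).image prodIdeal := by
    ext I
    simp only [Finset.mem_image]
    constructor
    · exact fun hI => ⟨S I, ⟨I, hI, rfl⟩, (hSI I hI).symm⟩
    · rintro ⟨T, ⟨J, hJ, rfl⟩, rfl⟩
      rwa [← hSI J hJ]
  rw [hUim, Finset.sum_image fun T _ T' _ h => prodIdeal_injective h]
  have hsub : U.image S ⊆ P.powerset := by
    intro T hT
    obtain ⟨I, hI, rfl⟩ := Finset.mem_image.1 hT
    exact Finset.mem_powerset.2 (hSP I hI)
  calc ∑ T ∈ U.image S, g (prodIdeal T) = ∑ T ∈ U.image S, ∏ v ∈ T, h v :=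
        Finset.sum_congr rfl fun T hT => hg T (Finset.mem_powerset.1 (hsub hT))
    _ ≤ ∑ T ∈ P.powerset, ∏ v ∈ T, h v :=
        Finset.sum_le_sum_of_subset_of_nonneg hsub fun T hT _ =>
          Finset.prod_nonneg fun v hv => hh v (Finset.mem_powerset.1 hT hv)

end Dedekind

/-! ### Number fields: squarefree ideals of bounded norm -/

section NumberField

variable (K : Type*) [Field K] [NumberField K]

open Literature.NumberTheory.LFunctions.NumberField

/-- A prime factor of an ideal of norm `≤ x` has norm `≤ x`; hence a squarefree nonzero ideal of
norm `≤ x` is `∏_{𝔭 ∈ S} 𝔭` with `S` inside the primes of norm `≤ x`. [folklore] -/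
theorem exists_eq_prodIdeal_subset_of_absNorm_le {I : Ideal (𝓞 K)} (hI : I ≠ 0) (hsq : Squarefree I)
    {x : ℝ} (hx : (Ideal.absNorm I : ℝ) ≤ x) :
    ∃ S : Finset (HeightOneSpectrum (𝓞 K)),
      (∀ v ∈ S, v.asIdeal ∈ (finite_primeIdealsLE K x).toFinset) ∧ I = prodIdeal S := by
  obtain ⟨S, rfl⟩ := exists_eq_prodIdeal_of_squarefree hI hsq
  refine ⟨S, fun v hv => ?_, rfl⟩
  rw [Set.Finite.mem_toFinset]
  refine ⟨v.isPrime, v.ne_bot, ?_⟩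
  have hdvd : Ideal.absNorm v.asIdeal ∣ Ideal.absNorm (prodIdeal S) :=
    Ideal.absNorm_dvd_absNorm_of_le (Ideal.le_of_dvd (dvd_prodIdeal_iff.2 hv))
  have hne : Ideal.absNorm (prodIdeal S) ≠ 0 := by
    rw [Ne, Ideal.absNorm_eq_zero_iff]; exact prodIdeal_ne_zero S
  have := Nat.le_of_dvd (Nat.pos_of_ne_zero hne) hdvd
  exact le_trans (by exact_mod_cast this) hx

/-- **Squarefree sums of bounded norm against `∏ a/(N𝔭 − 1)`-type weights are `≪ (log x)^a`**: for
`a ≥ 0` there is `C` such that for every finite set `U` of nonzero squarefree ideals of norm `≤ x`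
(`x ≥ 2`) and every `g` with `g(∏_{𝔭∈S} 𝔭) = ∏_{𝔭∈S} a/(N𝔭 − 1)`,
`∑_{𝔲 ∈ U} g(𝔲) ≤ C (log x)^a` — e.g. `∑_{N𝔲 ≤ R} μ²(𝔲)/φ(𝔲) ≪ log R` (`a = 1`, `φ(𝔭) = N𝔭 − 1`).
[cite: CastilloEtAl2015, proof of Lemma 2.2 (estimation of sums by Euler products)] -/
theorem sum_squarefree_le_log_pow {a : ℝ} (ha : 0 ≤ a) :
    ∃ C : ℝ, ∀ x : ℝ, 2 ≤ x → ∀ (U : Finset (Ideal (𝓞 K))) (g : Ideal (𝓞 K) → ℝ),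
      (∀ I ∈ U, I ≠ 0 ∧ Squarefree I ∧ (Ideal.absNorm I : ℝ) ≤ x) →
      (∀ S : Finset (HeightOneSpectrum (𝓞 K)),
        g (prodIdeal S) = ∏ v ∈ S, a / ((Ideal.absNorm v.asIdeal : ℝ) - 1)) →
      ∑ I ∈ U, g I ≤ C * Real.log x ^ a := by
  obtain ⟨C, hC⟩ := prod_one_add_div_absNorm_sub_one_le K ha
  refine ⟨C, fun x hx U g hU hg => ?_⟩
  -- the primes of norm `≤ x`, as height-one primes
  set T := (finite_primeIdealsLE K x).toFinset with hT
  have hinj : Set.InjOn (HeightOneSpectrum.asIdeal (R := 𝓞 K)) (HeightOneSpectrum.asIdeal ⁻¹' ↑T) :=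
    fun v _ w _ h => HeightOneSpectrum.ext h
  set P := T.preimage HeightOneSpectrum.asIdeal hinj with hP
  have hprod : ∏ v ∈ P, (1 + a / ((Ideal.absNorm v.asIdeal : ℝ) - 1)) =
      ∏ Q ∈ T, (1 + a / ((Ideal.absNorm Q : ℝ) - 1)) := by
    rw [hP, Finset.prod_preimage HeightOneSpectrum.asIdeal T hinj
      (fun Q => 1 + a / ((Ideal.absNorm Q : ℝ) - 1)) (fun Q hQ hnot => ?_)]
    exfalso
    rw [hT, Set.Finite.mem_toFinset] at hQ
    exact hnot ⟨⟨Q, hQ.1, hQ.2.1⟩, rfl⟩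
  have hh : ∀ v ∈ P, 0 ≤ a / ((Ideal.absNorm v.asIdeal : ℝ) - 1) := by
    intro v hv
    have h2 := two_le_absNorm_of_mem_primeIdealsLE (K := K) (Finset.mem_preimage.1 hv)
    have : (0 : ℝ) < (Ideal.absNorm v.asIdeal : ℝ) - 1 := by linarith
    positivity
  have hU' : ∀ I ∈ U, ∃ S ⊆ P, I = prodIdeal S := by
    intro I hI
    obtain ⟨hI0, hsq, hle⟩ := hU I hI
    obtain ⟨S, hS, rfl⟩ := exists_eq_prodIdeal_subset_of_absNorm_le K hI0 hsq hle
    exact ⟨S, fun v hv => Finset.mem_preimage.2 (hS v hv), rfl⟩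
  calc ∑ I ∈ U, g I ≤ ∏ v ∈ P, (1 + a / ((Ideal.absNorm v.asIdeal : ℝ) - 1)) :=
        sum_le_prod_one_add P hh (fun S _ => hg S) U hU'
    _ = ∏ Q ∈ T, (1 + a / ((Ideal.absNorm Q : ℝ) - 1)) := hprod
    _ ≤ C * Real.log x ^ a := hC x hx

end NumberField

end Literature.NumberTheory.Sieve.SquarefreeIdeal
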